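import Mathlib
import HarnessLib
import Summits.HubbardSuperconductivity.HubbardSuperconductivity.Theorems.KLProgrammeKLRegimeTwoVolumeTowerDefs
import Summits.HubbardSuperconductivity.HubbardSuperconductivity.Theorems.KLProgrammeKLRegimeTwoVolumeSpineDataDefs
import Summits.HubbardSuperconductivity.HubbardSuperconductivity.Theorems.KLProgrammeKLRegimeTwoVolumeDoubledData

/-!
# Route `KLProgramme` — crux K3, VL child `KLRegimeVolumeLimitV17F2` (stmt-HubbardSuperconductivity-20440), blueprint v5 M5 / W5: THE OBJECTS AND DATA BUNDLES
# OF THE TOWER SPINE (definitions; seat hubbard-kl-k3c4-p1 g13; `--supports` 20440; definition lane)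

The limit spine of the nested two-volume induction (`…TwoVolumeDefectSupSpine`) is assembled (`…TwoVolumeTowerSpine`) on the named tower of
`…TwoVolumeTowerDefs` over the instances `(L, b, M)` (coarse volume `L`, fine volume `b·L`, Matsubara cutoff `M`).  This file NAMES what the assembly and its
data dischargers share:

* `klBlockEquiv L b M N` / `klBlockEquivD L b M n` — THE canonical block structure of the (doubled) sector-field labels of the fine torus `b·L` over the coarse
  torus `L` (a choice from `exists_sectorFieldBlockEquiv` / `exists_doubledEquiv`; any block structure with the defining properties is this one, but only the
  properties are ever used): `klBlockEquiv_val`, `klBlockEquiv_snd`, `klBlockEquivD_apply`, `klBlockEquivD_symm_apply`;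
* `klKeyedDefect L b M β U μ Kc Kf j k p w` — the KEYED two-volume defect at step `j`, raw degree `k`, pin slot `p`, fine pin `w`: the pinned sum over fine label
  strings of `‖kernel (klTowerState (bL) … Kf j) k X − [X in one block] · kernel (klTowerState L … Kc j) k (residues of X)‖` (`Kc`, `Kf` = the two volumes' frames);
  `klKeyedDefect_nonneg`;
* `TowerVolumeData` — the OWN-FRAME one-volume data of a volume `V` at its frame `K` up to `J` steps: partition functions nonzero, parity of the read-outs
  `klTowerD V … K j`, the step-covariance bundles `ScaleCovData (klStepCov V … K j)`, and E1's even weighted profiles of `klTowerD V … K j` (normalised `ε·NV j`);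
* `TowerCrossData` — the data of the fine volume `b·L` AT THE COARSE FRAME `Kc` (covariance bundle, sectional row, transfer bundle at the canonical block structures)
  and its own-frame MISMATCH data against `Kf` (Gram path, entry sup `sE j`, rows/columns `cR j/ε, cC j/ε`, transfer rows/columns `δ j`);
* `TowerScaleSmall` — the VOLUME-FREE smallness of one scale: the ten dominating series (as `HasSum`s naming `ν₀ … ν₈, νE`) and the seven barred `θ < 1` lines of
  `…TwoVolumeTowerStep`, in the L-free budgets `NV` (E1's even profile of scale `j`), `NS` (raw profile of the states of step `j`) and the caps `cRb, cCb, δb`.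

Definitions (with bodies) and their trivial unfoldings only; nothing about the model is asserted.
-/

noncomputable section

namespace Summit.HubbardSuperconductivity.HubbardSuperconductivity.Theorems.TwoVolumeSource

set_option linter.dupNamespace false -- summit = problem name (single-conjunct summit), D-0017

open Finset Literature.MathematicalPhysics.QuantumLattice GrassmannAlgebra Literature.Probability.LatticeModels
  Literature.Probability.LatticeModels.BattleFederbush
open Summit.HubbardSuperconductivity.HubbardSuperconductivity.Theorems.TwoPointAssembly
open Summit.HubbardSuperconductivity.HubbardSuperconductivity.Theorems.KLRegimeSplit
open Summit.HubbardSuperconductivity.HubbardSuperconductivity.Theorems.KLProgrammeLegKernels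
open Summit.HubbardSuperconductivity.HubbardSuperconductivity.Theorems.EngineV8
open Summit.HubbardSuperconductivity.HubbardSuperconductivity.Theorems.TwoVolumeDefect

/-! ## §1 The canonical block structures -/

section Blocks

variable (L b M : ℕ) [NeZero L] [NeZero (b * L)]

/-- **The canonical block structure** of the sector-field labels of the fine torus `b·L` over the coarse torus `L` (block of the site, residue label).
[folklore] -/
def klBlockEquiv (N : ℕ) : (SpaceTimeIdx (b * L) M × SectorLeg N) ≃ (Fin 2 → Fin b) × (SpaceTimeIdx L M × SectorLeg N) :=
  Classical.choose (exists_sectorFieldBlockEquiv (Lf := b * L) (b := b) (L := L) rfl M N)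

/-- The block coordinates of the canonical block structure are `⌊x_i / L⌋`. [folklore] -/
theorem klBlockEquiv_val (N : ℕ) (X' : SpaceTimeIdx (b * L) M × SectorLeg N) (i : Fin 2) :
    ((klBlockEquiv L b M N X').1 i : ℕ) = (X'.1.2 i).val / L :=
  (Classical.choose_spec (exists_sectorFieldBlockEquiv (Lf := b * L) (b := b) (L := L) rfl M N)).1 X' i

/-- The residue label of the canonical block structure is `((x₀, x⃗ mod L), ℓ)`. [folklore] -/
theorem klBlockEquiv_snd (N : ℕ) (X' : SpaceTimeIdx (b * L) M × SectorLeg N) :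
    (klBlockEquiv L b M N X').2 = ((X'.1.1, fun i => (((X'.1.2 i).val : ℕ) : ZMod L)), X'.2) :=
  (Classical.choose_spec (exists_sectorFieldBlockEquiv (Lf := b * L) (b := b) (L := L) rfl M N)).2 X'

/-- **The canonical DOUBLED block structure** of the doubled labels `SrcLabel (b·L) M n` (same block, same copy). [folklore] -/
def klBlockEquivD (n : ℕ) : SrcLabel (b * L) M n ≃ (Fin 2 → Fin b) × SrcLabel L M n :=
  Classical.choose (exists_doubledEquiv (klBlockEquiv L b M (sectorCount n)))

/-- The doubled block structure on a doubled label. [folklore] -/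
theorem klBlockEquivD_apply (n : ℕ) (x : SpaceTimeIdx (b * L) M × SectorLeg (sectorCount n)) (s : Fin 2) :
    klBlockEquivD L b M n (x, s) = ((klBlockEquiv L b M (sectorCount n) x).1, ((klBlockEquiv L b M (sectorCount n) x).2, s)) :=
  (Classical.choose_spec (exists_doubledEquiv (klBlockEquiv L b M (sectorCount n)))).1 x s

/-- The inverse of the doubled block structure. [folklore] -/
theorem klBlockEquivD_symm_apply (n : ℕ) (blk : Fin 2 → Fin b) (y : SpaceTimeIdx L M × SectorLeg (sectorCount n)) (s : Fin 2) :
    (klBlockEquivD L b M n).symm (blk, (y, s)) = ((klBlockEquiv L b M (sectorCount n)).symm (blk, y), s) :=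
  (Classical.choose_spec (exists_doubledEquiv (klBlockEquiv L b M (sectorCount n)))).2 blk y s

end Blocks

/-! ## §2 The keyed two-volume defect of the tower states -/

section Defect

variable (L b M : ℕ) [NeZero L] [NeZero (b * L)]

/-- **The keyed two-volume defect** of the tower states at step `j` (fine volume `b·L` at frame `Kf`, coarse volume `L` at frame `Kc`), raw degree `k`, pin slot
`p`, fine pin `w`: `Σ_{X : X p = w} ‖kernel (state″_j) k X − [all X_i in the block of X_p] · kernel (state_j) k (residues of X)‖`.
[cite: BenfattoGiulianiMastropietro2006, §2.9 (4.3)-(4.6)] -/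
def klKeyedDefect (β U μ : ℝ) (Kc Kf : TrigPolyC4v) (j k : ℕ) (p : Fin k) (w : SrcLabel (b * L) M (j - 1)) : ℝ :=
  ∑ X ∈ univ.filter (fun X : Fin k → SrcLabel (b * L) M (j - 1) => X p = w),
    ‖kernel ℂ (klTowerState (b * L) M β U μ Kf j) k X -
      (if ∀ i, (klBlockEquivD L b M (j - 1) (X i)).1 = (klBlockEquivD L b M (j - 1) (X p)).1 then
        kernel ℂ (klTowerState L M β U μ Kc j) k (fun i => (klBlockEquivD L b M (j - 1) (X i)).2) else 0)‖

variable {L b M}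

/-- Unfolding `klKeyedDefect`. [folklore] -/
theorem klKeyedDefect_eq (β U μ : ℝ) (Kc Kf : TrigPolyC4v) (j k : ℕ) (p : Fin k) (w : SrcLabel (b * L) M (j - 1)) :
    klKeyedDefect L b M β U μ Kc Kf j k p w =
      ∑ X ∈ univ.filter (fun X : Fin k → SrcLabel (b * L) M (j - 1) => X p = w),
        ‖kernel ℂ (klTowerState (b * L) M β U μ Kf j) k X -
          (if ∀ i, (klBlockEquivD L b M (j - 1) (X i)).1 = (klBlockEquivD L b M (j - 1) (X p)).1 then
            kernel ℂ (klTowerState L M β U μ Kc j) k (fun i => (klBlockEquivD L b M (j - 1) (X i)).2) else 0)‖ := rfl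

/-- The keyed defect is nonnegative. [folklore] -/
theorem klKeyedDefect_nonneg (β U μ : ℝ) (Kc Kf : TrigPolyC4v) (j k : ℕ) (p : Fin k) (w : SrcLabel (b * L) M (j - 1)) :
    0 ≤ klKeyedDefect L b M β U μ Kc Kf j k p w :=
  sum_nonneg fun _ _ => norm_nonneg _

end Defect

/-! ## §3 The data bundles of the spine -/

/-- **`TowerVolumeData V M β U μ K J ε Λ κ aW sW NV`** — the OWN-FRAME one-volume data of the volume `V` at its frame `K` for `J` steps, normalisation `ε`:
the partition functions of the integrated scales are nonzero; the read-outs `klTowerD V … K j` are even without constant part; the step covariances carry the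
bundles `ScaleCovData (klStepCov V … K j) (Λ j) (κ j) (aW j / ε) (sW j)`; E1's even `Λ j`-weighted profiles of `klTowerD V … K j` are `≤ ε · NV j`. -/
structure TowerVolumeData (V M : ℕ) [NeZero V] (β U μ : ℝ) (K : TrigPolyC4v) (J : ℕ) (ε : ℝ) (Λ κ aW sW : ℕ → ℝ) (NV : ℕ → ℕ → ℝ) : Prop where
  /-- partition functions of the integrated scales -/
  Z : ∀ k, k + 1 ≤ J → hubbardEffPartitionFnCT V M β U μ 0 K (klScale klE0 (k + 1)) ≠ 0
  /-- parity of the read-outs -/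
  parity : ∀ j, j ≤ J → klTowerD V M β U μ K j ∈ evenOdd ℂ 0 ∧ constPart ℂ (klTowerD V M β U μ K j) = 0
  /-- step-covariance bundles -/
  cov : ∀ j, j < J → ScaleCovData (klStepCov V M β μ K j) (Λ j) (κ j) (aW j / ε) (sW j)
  /-- E1's even weighted profiles (normalised) -/
  profile : ∀ j, j ≤ J → WtProfileEven (klTowerD V M β U μ K j) (Λ j) (fun m => ε * NV j m)

/-- **`TowerCrossData L b M β μ Kc Kf J ε Λ κ' aW' sW' eW' ΛT cW κf sE cR cC δ`** — the data of the fine volume `b·L` AT THE COARSE FRAME `Kc` (covariance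
bundle, sectional row, transfer bundle at the canonical block structures) and its MISMATCH data against its own frame `Kf` (Gram path with constant `κf j`,
entry sup `sE j`, rows `cR j / ε`, columns `cC j / ε` of `klStepCov (bL) Kf j − klStepCov (bL) Kc j`; rows and columns `δ j` of
`klTowerTransfer (bL) Kf j − klTowerTransfer (bL) Kc j`), for the steps `j < J` (the transfer data also at the END `j = J`). -/
structure TowerCrossData (L b M : ℕ) [NeZero L] [NeZero (b * L)] (β μ : ℝ) (Kc Kf : TrigPolyC4v) (J : ℕ) (ε : ℝ)
    (Λ κ' aW' sW' eW' ΛT cW κf sE cR cC δ : ℕ → ℝ) : Prop where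
  /-- covariance bundle at the coarse frame -/
  cov : ∀ j, j < J → ScaleCovData (klStepCov (b * L) M β μ Kc j) (Λ j) (κ' j) (aW' j / ε) (sW' j)
  /-- sectional row at the coarse frame -/
  sec : ∀ j, j < J → ScaleCovSecData (klStepCov (b * L) M β μ Kc j) (Λ j) (eW' j)
  /-- transfer bundle at the coarse frame (steps `j < J` and the END transfer `j = J`) -/
  transfer : ∀ j, j ≤ J → TransferWtData (klTowerTransfer (b * L) M β μ Kc j) (klBlockEquivD L b M j) (klBlockEquivD L b M (j - 1)) (ΛT j) (cW j)
  /-- Gram path between the two frames -/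
  gramPath : ∀ j, j < J → ∀ t ∈ Set.Icc (0 : ℝ) 1,
    IsGramBoundedR (klStepCov (b * L) M β μ Kc j + t • (klStepCov (b * L) M β μ Kf j - klStepCov (b * L) M β μ Kc j)) (κf j)
  /-- entry sup of the covariance mismatch -/
  entry : ∀ j, j < J → ∀ x y, ‖(klStepCov (b * L) M β μ Kf j - klStepCov (b * L) M β μ Kc j) x y‖ ≤ sE j
  /-- rows of the covariance mismatch -/
  row : ∀ j, j < J → ∀ x, ∑ y, ‖(klStepCov (b * L) M β μ Kf j - klStepCov (b * L) M β μ Kc j) x y‖ ≤ cR j / ε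
  /-- columns of the covariance mismatch -/
  col : ∀ j, j < J → ∀ y, ∑ x, ‖(klStepCov (b * L) M β μ Kf j - klStepCov (b * L) M β μ Kc j) x y‖ ≤ cC j / ε
  /-- rows of the transfer mismatch (`j ≤ J`) -/
  trow : ∀ j, j ≤ J → ∀ x, ∑ y, ‖klTowerTransfer (b * L) M β μ Kf j x y - klTowerTransfer (b * L) M β μ Kc j x y‖ ≤ δ j
  /-- columns of the transfer mismatch (`j ≤ J`) -/
  tcol : ∀ j, j ≤ J → ∀ y, ∑ x, ‖klTowerTransfer (b * L) M β μ Kf j x y - klTowerTransfer (b * L) M β μ Kc j x y‖ ≤ δ j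

/-- **`TowerScaleSmall`** — the VOLUME-FREE smallness of one scale of the spine.  Inputs: the scale's constants (coarse/fine Gram `κ, κ′`, rows `aW, aW′`,
transfer mass `cW`, mismatch Gram `κf`, caps `cRb, cCb, δb`, radii `ρ₀, ρf, ρ₂, ρ′, ρ₃`), E1's L-free even profile `NV` of the scale, the L-free raw profile `NS`
of the scale's states, and the ten series values `ν₀ … ν₈, νE`.  Content: the ten dominating series converge to the named values (`HasSum`; weights
`(e²(K+ρ))^{2m}` of `normV`) and the seven barred `θ < 1` lines of `…TwoVolumeTowerStep` hold for them. -/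
structure TowerScaleSmall (κ κ' aW aW' cW κf cRb cCb δb ρ₀ ρf ρ₂ ρ' ρ₃ : ℝ) (NV NS : ℕ → ℝ) (ν₀ ν₁ ν₂ ν₃ ν₄ ν₅ νE ν₆ ν₇ ν₈ : ℝ) : Prop where
  /-- `ν₀ = Σ (e²(κ+ρ₀))^{2m} NV m` -/
  hν₀ : HasSum (fun m => (Real.exp 2 * (κ + ρ₀)) ^ (2 * m) * NV m) ν₀
  /-- `θ₀ < 1` -/
  hθ₀ : Real.exp 1 * aW * ν₀ / κ ^ 2 < 1
  /-- `ν₅ = Σ (e²(κ′+κ+ρf))^{2m} Nw₁ m`, `Nw₁ m = ρ₀^{-2m} e ν₀ / (1 − θ₀)` -/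
  hν₅ : HasSum (fun m => (Real.exp 2 * (κ' + κ + ρf)) ^ (2 * m) * (ρ₀⁻¹ ^ (2 * m) * (Real.exp 1 * ν₀) / (1 - Real.exp 1 * aW * ν₀ / κ ^ 2))) ν₅
  /-- `θw < 1` -/
  hθw : Real.exp 1 * (aW' + aW + (aW' + aW)) * ν₅ / (κ' + κ) ^ 2 < 1
  /-- `ν₄ = Σ (e²(3(κ′+κ)+ρ₂))^{2m} Nw₁ m` -/
  hν₄ : HasSum (fun m => (Real.exp 2 * (κ' + κ + (κ' + κ + (κ' + κ)) + ρ₂)) ^ (2 * m) *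
    (ρ₀⁻¹ ^ (2 * m) * (Real.exp 1 * ν₀) / (1 - Real.exp 1 * aW * ν₀ / κ ^ 2))) ν₄
  /-- `θ₂ < 1` -/
  hθ₂ : Real.exp 1 * (aW' + aW + (aW' + aW)) * ν₄ / (κ' + κ + (κ' + κ + (κ' + κ))) ^ 2 < 1
  /-- `ν₁ = Σ (e²(κ′+ρ′))^{2m} (NV m + (NW′ m + NV m))`, `NW′ m = cW^{2m−1} (cW · NS (2m))` -/
  hν₁ : HasSum (fun m => (Real.exp 2 * (κ' + ρ')) ^ (2 * m) * (NV m + (cW ^ (2 * m - 1) * (cW * NS (2 * m)) + NV m))) ν₁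
  /-- `ν₂ = Σ (e²(κ′+ρ′))^{2m} (NW′ m + NV m)` -/
  hν₂ : HasSum (fun m => (Real.exp 2 * (κ' + ρ')) ^ (2 * m) * (cW ^ (2 * m - 1) * (cW * NS (2 * m)) + NV m)) ν₂
  /-- `ν₃ = Σ (e²(κ′+ρ′))^{2m} NV m` -/
  hν₃ : HasSum (fun m => (Real.exp 2 * (κ' + ρ')) ^ (2 * m) * NV m) ν₃
  /-- `νE = Σ (e²(κ′+ρ′))^{2m} t̄b m`, `t̄b` the dominating transfer bound of the scale (`a = τ̄ = cW`, `Ē = ND = 2·NS`, `N = N̄far = NS`) -/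
  hνE : HasSum (fun m => (Real.exp 2 * (κ' + ρ')) ^ (2 * m) *
    (cW ^ (2 * m - 1) * (cW * (2 * NS (2 * m)) + cW * (2 * NS (2 * m))) +
      (2 * cW ^ (2 * m - 1) * cW * NS (2 * m) + ((2 * m - 1 : ℕ) : ℝ) * cW ^ (2 * m - 1) * (5 * cW * NS (2 * m) + 2 * cW * NS (2 * m))))) νE
  /-- the barred `θ̄ < 1` -/
  hbar : Real.exp 1 * aW' * (ν₁ + νE) / κ' ^ 2 < 1
  /-- `θ₂′ < 1` -/
  hθ₂' : Real.exp 1 * aW' * (ν₃ + ν₂) / κ' ^ 2 < 1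
  /-- `ν₆ = Σ (e²(κf+ρ₃))^{2m} (NW′ m + (2m)(cW+δb)^{2m−1} δb NS (2m))` -/
  hν₆ : HasSum (fun m => (Real.exp 2 * (κf + ρ₃)) ^ (2 * m) *
    (cW ^ (2 * m - 1) * (cW * NS (2 * m)) + (2 * m : ℕ) * (cW + δb) ^ (2 * m - 1) * δb * NS (2 * m))) ν₆
  /-- `ν₇ = Σ (e²(κf+ρ₃))^{2m} NW′ m` -/
  hν₇ : HasSum (fun m => (Real.exp 2 * (κf + ρ₃)) ^ (2 * m) * (cW ^ (2 * m - 1) * (cW * NS (2 * m)))) ν₇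
  /-- `ν₈ = Σ (e²(κf+ρ₃))^{2m} (2m)(cW+δb)^{2m−1} NS (2m)` -/
  hν₈ : HasSum (fun m => (Real.exp 2 * (κf + ρ₃)) ^ (2 * m) * ((2 * m : ℕ) * (cW + δb) ^ (2 * m - 1) * NS (2 * m))) ν₈
  /-- `θf₁ < 1` -/
  hθf₁ : Real.exp 1 * (aW' + (cRb + cCb)) * ν₆ / κf ^ 2 < 1
  /-- `θf₂ < 1` -/
  hθf₂ : Real.exp 1 * aW' * (ν₇ + δb * ν₈) / κf ^ 2 < 1

end Summit.HubbardSuperconductivity.HubbardSuperconductivity.Theorems.TwoVolumeSource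

end
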